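import Summits.Ventures.HodgeRepro2.T5SU11RadialGreenPositivity
import Summits.Ventures.HodgeRepro2.T5SU11KernelTwoSidedBound

/-!
# The semi-separable structure of the kernel: the rank-one identity, the diagonal, and the geometric-mean bound
`|K_λ(t, s)| ≤ √(|K_λ(t, t)| |K_λ(s, s)|)`

The kernel `K_λ(t, s) = −φ_λ(min(t, s)) χ_λ(max(t, s))` is SEMI-SEPARABLE: on each side of the diagonal it is a product of a
function of `t` and a function of `s`. Hence

* `kernel_rank_one` — **`K_λ(t, s) K_λ(t′, s′) = K_λ(t, s′) K_λ(t′, s)`** whenever `t, t′ ≤ s, s′` (every `2 × 2` minor with both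
  rows below both columns vanishes: the kernel has rank one on each side of the diagonal);
* `kernel_diagonal_eq` — **`K_λ(t, t) = −φ_λ(a_t)² T_λ(t)`** with `T_λ(t) = ∫_t^∞ ds/(sinh 2s φ_λ(a_s)²)` the tail integral;
* `tailIntegral_antitoneOn` — the tail integral decreases;
* `abs_kernel_mul_le_diagonal` — **`K_λ(t, s)² ≤ K_λ(t, t) K_λ(s, s)`**, i.e. `|K_λ(t, s)| ≤ √(|K_λ(t, t)| |K_λ(s, s)|)`: the
  kernel is dominated by the geometric mean of its diagonal values (for `t ≤ s`, `φ_λ(a_t) χ_λ(s) ≤ φ_λ(a_s) χ_λ(t)` because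
  `χ_λ/φ_λ = T_λ` decreases);
* `abs_kernel_le_sqrt_diagonal` — the same with the square root.

Nothing is claimed about (N).

Blind lane: Mathlib + the HodgeRepro2 prefix only; no sorry; axioms ⊆ {propext, Classical.choice,
Quot.sound}.
-/

namespace Summit.Ventures.HodgeRepro2.T5SU11KernelSemiSeparable

open Filter Topology MeasureTheory
open Set (Ioi Ioc)
open T5SU11Cartan T5SU11SphericalFunction T5SU11SphericalBounds T5SU11SphericalDecay T5SU11SphericalSolutionSpaceAll
  T5SU11ReductionOfOrder T5SU11ReductionOfOrderInfinity T5SU11RadialGreenKernel T5SU11RadialGreenPositivity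
  T5SU11KernelTwoSidedBound

section measure

variable [MeasurableSpace Circle] [BorelSpace Circle]

omit [BorelSpace Circle] in
/-- **The rank-one identity**: `K_λ(t, s) K_λ(t′, s′) = K_λ(t, s′) K_λ(t′, s)` whenever `t, t′ ≤ s, s′`. -/
theorem kernel_rank_one (lam : ℝ) {t t' s s' : ℝ} (hts : t ≤ s) (hts' : t ≤ s') (ht's : t' ≤ s) (ht's' : t' ≤ s') :
    sphGreenKernel lam t s * sphGreenKernel lam t' s' = sphGreenKernel lam t s' * sphGreenKernel lam t' s := by
  unfold sphGreenKernel
  rw [greenKernel_of_ge _ _ hts, greenKernel_of_ge _ _ hts', greenKernel_of_ge _ _ ht's, greenKernel_of_ge _ _ ht's']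
  ring

omit [BorelSpace Circle] in
/-- **The diagonal of the kernel**: `K_λ(t, t) = −φ_λ(a_t)² T_λ(t)`. -/
theorem kernel_diagonal_eq (lam t : ℝ) :
    sphGreenKernel lam t t = -(sph lam (hyp t) ^ 2 * tailIntegral (fun t => sph lam (hyp t)) t) := by
  unfold sphGreenKernel greenKernel
  rw [min_self, max_self]
  have e : sphDecay lam t = sph lam (hyp t) * tailIntegral (fun t => sph lam (hyp t)) t := rfl
  rw [e]
  ring

variable {lam : ℝ} (hlam : 1 < lam)

include hlam in
/-- **The tail integral decreases** on `(0, ∞)`: `T_λ(s) ≤ T_λ(t)` for `0 < t ≤ s`. -/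
theorem tailIntegral_antitoneOn : AntitoneOn (tailIntegral fun t => sph lam (hyp t)) (Ioi 0) := by
  intro t ht s _ hts
  unfold tailIntegral
  apply setIntegral_mono_set (integrableOn_roIntegrand_Ioi (hφ_sph lam) (hpos_sph lam)
    (integrableOn_roIntegrand_sph hlam) ht)
  · refine (ae_restrict_iff' measurableSet_Ioi).mpr (Eventually.of_forall fun u hu => ?_)
    unfold roIntegrand
    have h1 : 0 < Real.sinh (2 * u) := sinh_two_mul_pos (lt_trans ht hu)
    have h2 := sph_hyp_pos lam u
    positivity
  · exact (Set.Ioi_subset_Ioi hts).eventuallyLE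

include hlam in
/-- **`φ_λ(a_t) χ_λ(s) ≤ φ_λ(a_s) χ_λ(t)` for `0 < t ≤ s`**: the ratio `χ_λ/φ_λ = T_λ` decreases. -/
theorem sph_mul_sphDecay_le {t s : ℝ} (ht : 0 < t) (hts : t ≤ s) :
    sph lam (hyp t) * sphDecay lam s ≤ sph lam (hyp s) * sphDecay lam t := by
  have hT := tailIntegral_antitoneOn hlam (show t ∈ Ioi (0 : ℝ) from ht)
    (show s ∈ Ioi (0 : ℝ) from lt_of_lt_of_le ht hts) hts
  have e1 : sphDecay lam s = sph lam (hyp s) * tailIntegral (fun t => sph lam (hyp t)) s := rfl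
  have e2 : sphDecay lam t = sph lam (hyp t) * tailIntegral (fun t => sph lam (hyp t)) t := rfl
  rw [e1, e2]
  have hφt : 0 ≤ sph lam (hyp t) := (sph_hyp_pos lam t).le
  have hφs : 0 ≤ sph lam (hyp s) := (sph_hyp_pos lam s).le
  calc sph lam (hyp t) * (sph lam (hyp s) * tailIntegral (fun t => sph lam (hyp t)) s)
      = (sph lam (hyp t) * sph lam (hyp s)) * tailIntegral (fun t => sph lam (hyp t)) s := by ring
    _ ≤ (sph lam (hyp t) * sph lam (hyp s)) * tailIntegral (fun t => sph lam (hyp t)) t :=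
        mul_le_mul_of_nonneg_left hT (mul_nonneg hφt hφs)
    _ = sph lam (hyp s) * (sph lam (hyp t) * tailIntegral (fun t => sph lam (hyp t)) t) := by ring

include hlam in
/-- **THE GEOMETRIC-MEAN BOUND**: `K_λ(t, s)² ≤ K_λ(t, t) K_λ(s, s)` for `t, s > 0`. -/
theorem abs_kernel_mul_le_diagonal {t s : ℝ} (ht : 0 < t) (hs : 0 < s) :
    sphGreenKernel lam t s ^ 2 ≤ sphGreenKernel lam t t * sphGreenKernel lam s s := by
  -- reduce to `t ≤ s` by the symmetry of the kernel
  wlog hts : t ≤ s generalizing t s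
  · have h := this hs ht (le_of_not_ge hts)
    rw [sphGreenKernel_symm lam t s, mul_comm]
    exact h
  unfold sphGreenKernel
  rw [greenKernel_of_ge _ _ hts, greenKernel_of_ge _ _ le_rfl, greenKernel_of_ge _ _ le_rfl]
  have h := sph_mul_sphDecay_le hlam ht hts
  have hφt : 0 < sph lam (hyp t) := sph_hyp_pos lam t
  have hχs : 0 < sphDecay lam s := sphDecay_pos hlam (lt_of_lt_of_le ht hts)
  -- `(φ(t) χ(s))² ≤ (φ(t) χ(s)) (φ(s) χ(t)) = (φ(t) χ(t)) (φ(s) χ(s))`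
  calc (-(sph lam (hyp t) * sphDecay lam s)) ^ 2 = (sph lam (hyp t) * sphDecay lam s) * (sph lam (hyp t) * sphDecay lam s) := by
        ring
    _ ≤ (sph lam (hyp t) * sphDecay lam s) * (sph lam (hyp s) * sphDecay lam t) :=
        mul_le_mul_of_nonneg_left h (mul_pos hφt hχs).le
    _ = -(sph lam (hyp t) * sphDecay lam t) * -(sph lam (hyp s) * sphDecay lam s) := by ring

include hlam in
/-- **`|K_λ(t, s)| ≤ √(|K_λ(t, t)| |K_λ(s, s)|)`** for `t, s > 0`. -/
theorem abs_kernel_le_sqrt_diagonal {t s : ℝ} (ht : 0 < t) (hs : 0 < s) :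
    |sphGreenKernel lam t s| ≤ Real.sqrt (|sphGreenKernel lam t t| * |sphGreenKernel lam s s|) := by
  have h := abs_kernel_mul_le_diagonal hlam ht hs
  have e : |sphGreenKernel lam t t| * |sphGreenKernel lam s s| = sphGreenKernel lam t t * sphGreenKernel lam s s := by
    rw [abs_of_neg (sphGreenKernel_neg hlam (s := t) ht), abs_of_neg (sphGreenKernel_neg hlam (s := s) hs)]
    ring
  rw [e, ← Real.sqrt_sq_eq_abs]
  exact Real.sqrt_le_sqrt h

end measure

end Summit.Ventures.HodgeRepro2.T5SU11KernelSemiSeparable
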